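import Summits.QuantumFields.BalabanUV.T4Continuum.Support.DirichletDipSmoothPart

/-!
# `BalabanUV.T4Continuum.Support.DirichletDipCutoffCorner` — NE2 (node U1a) formalisation swarm, sub-row `T4-U1a.S-NE2-D1-DIRICHLET°`, supplier item
# «Δ1-SKELETON» (file 6): THE DIPS ARE INTRINSICALLY SMOOTH AWAY FROM THE CORNERS OF THEIR BOTTOM FACE — `|Δ dip_β| ≤ 2·lip1 R` along every
# `Ω`-bond and `|Δ² dip_β| ≤ 2·lip2 R` along every `Ω`-triple whose centre is not `NearCorner β` (within `2R + 1` of the bottom plane of `β`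
# AND of two distinct transversal face planes of `β`, i.e. of a codimension-3 cell of the boundary of the block region)
# (unit b2b-balaban-t4-ne2-formalise-leaf-08, gen 7, file 6)

HONEST FRAMING.  Rung (B)+1 bookkeeping at MODEL level, finite torus; pure lattice combinatorics; NE2 (U1a) is NOT proved by this file;
spine PROVED 0/9 unchanged; NOT infinite volume, NOT the mass gap, NOT Clay.  HONEST DEPENDENCY (verbatim): «continuum YM on T⁴ ⇐ BetaPertH ∧
nine spine estimates (0/9 proved); BetaPertH ⇐ (D1) ∧ (D4) ∧ CAP+tail; G-an2-4 gates asym, D1 and NE2/3/4.»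

THE MECHANISM.  `dip_β = Gs_β · conn_β` with `Gs_β` unconditionally smooth (file 5) and `conn_β ∈ {0,1}` constant inside blocks; across a
`μ`-face inside `Ω` the indicator is continuous or `Gs_β` vanishes on both sides (top ∕ bottom layers are `≥ 2R − 1` sites from the plane);
across a transversal face inside `Ω` in the layer BELOW `β` with `Gs_β ≠ 0` the site is `NearCorner β` (**`nearCorner_of_lower_cross`**:
if every other transversal coordinate agreed with `β`, one end of the bond would lie in the exterior block `β − e_μ`).  Hence
**`dip_step_mu`**, **`dip_second_mu`** (no corner hypothesis), **`dip_step_tr`**, **`dip_second_tr`** (centre not `NearCorner β`), for every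
block set `S`, every `d`, every torus, `2 ≤ R`, `4R ≤ n`.

ABSOLUTE RULE (cell, verbatim): «No internally-minted statement may enter as a cited fact. Every hypothesis is either kernel-proved in
this package or a verbatim quotation of a PUBLISHED theorem with page reference. The manuscript(s) under audit are NOT citable for
their own disputed steps — they are the thing under adjudication; programme-internal (2001/route/tribunal) claims are never citable.»
[folklore] lattice bookkeeping; [shape] predicates `NearPlane` ∕ `NearFace` ∕ `NearCorner` on data; no `def … : Prop` fact.  NOT CLAIMED: the
smoothness structure of `psiS` (next file); NE2; NE3.
-/

noncomputable section

open scoped BigOperators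
open Finset

namespace Summit.QuantumFields.BalabanUV.T4Continuum.DirichletDipCutoffCorner

open Literature.MathematicalPhysics.QuantumFieldTheory.Balaban1983to89.B5Prop11Plancherel (Tor fine unitVec)
open Literature.MathematicalPhysics.QuantumFieldTheory.Balaban1983to89.B5Blocks16 (blockOf)
open Summit.QuantumFields.BalabanUV.Beta.GAN24.DirichletBoxTrace (blockReg)
open Summit.QuantumFields.BalabanUV.T4Continuum.DirichletMonotoneCutoff (offsF blockOf_offsF_add_of_lt blockOf_offsF_add_of_eq blockOf_offsF_sub)
open Summit.QuantumFields.BalabanUV.T4Continuum.ScaleProfile (qprof qprof_eq_one qprof_eq_zero lip1 lip2 lip1_nonneg lip2_nonneg)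
open Summit.QuantumFields.BalabanUV.T4Continuum.DirichletDipCutoff (BotExp hV Wax Ptr conn Gs dip hV_mem Wax_mem Ptr_mem conn_mem Gs_mem
  Gs_eq_of_botExp Gs_eq_zero_of_not_botExp hV_eq_zero_of_far hV_eq_zero_of_top hV_eq_zero_of_bot conn_eq_one_of_up conn_eq_of_dn
  conn_eq_zero_of_far Ptr_eq_zero_of dip_eq_zero_of_hV)
open Summit.QuantumFields.BalabanUV.T4Continuum.DirichletDipCutoffAxis (add_unitVec_self add_unitVec_ne sub_unitVec_self sub_unitVec_ne
  one_ne_zero_of_botExp hV_add_of_ne hV_sub_of_ne Wax_add_of_ne Wax_sub_of_ne Gs_cross Gs_step Gs_second q_values)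

variable {d : ℕ} (n : ℕ) [NeZero n] (M : Fin d → ℕ) [hM : ∀ μ, NeZero (M μ)] (μ : Fin d) (R : ℕ)

/-! ## §1 The corner predicates -/

/-- [shape] `x` is within the height window (with margin) of the bottom plane of `β`. [folklore] -/
def NearPlane (β : Tor M) (x : Tor (fine n M)) : Prop :=
  (blockOf n M x μ = β μ ∧ (offsF n M x μ : ℕ) ≤ 2 * R) ∨ (blockOf n M x μ = β μ - 1 ∧ n ≤ (offsF n M x μ : ℕ) + 2 * R + 1)

/-- [shape] `x` is within `2R + 1` of one of the two `κ`-face planes of the column of `β`. [folklore] -/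
def NearFace (β : Tor M) (κ : Fin d) (x : Tor (fine n M)) : Prop :=
  (blockOf n M x κ = β κ ∧ ((offsF n M x κ : ℕ) ≤ 2 * R ∨ n ≤ (offsF n M x κ : ℕ) + 2 * R + 1))
    ∨ (blockOf n M x κ = β κ + 1 ∧ (offsF n M x κ : ℕ) ≤ 2 * R) ∨ (blockOf n M x κ = β κ - 1 ∧ n ≤ (offsF n M x κ : ℕ) + 2 * R + 1)

/-- [shape] **`x` is NEAR A BOTTOM CORNER CELL of `β`**: near its bottom plane, near two DISTINCT transversal face planes, and inside
the (window-extended) range of `β` along every transversal axis — i.e. within `2R + 1` (sup-distance) of a codimension-3 cell on the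
boundary of the bottom face of `β`. [folklore] -/
def NearCorner (β : Tor M) (x : Tor (fine n M)) : Prop :=
  NearPlane n M μ R β x ∧ (∃ κ₁ κ₂ : Fin d, κ₁ ≠ μ ∧ κ₂ ≠ μ ∧ κ₁ ≠ κ₂ ∧ NearFace n M R β κ₁ x ∧ NearFace n M R β κ₂ x)
    ∧ ∀ lam : Fin d, lam ≠ μ → blockOf n M x lam = β lam ∨ NearFace n M R β lam x

/-! ## §2 Supports of the factors -/

section Supports

variable {n M μ R} {S : Tor M → Prop} [DecidablePred S] (hR : 2 ≤ R) (hn : 4 * R ≤ n) {β : Tor M}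
include hR hn

omit hn in
/-- `q i ≠ 0` forces `i ≤ 2R − 2`. [folklore] -/
theorem le_of_qprof_ne_zero {i : ℕ} (h : qprof R R i ≠ 0) : i + 2 ≤ 2 * R := by
  by_contra h'
  exact h (qprof_eq_zero hR R (by omega))

omit hn in
/-- `hV ≠ 0` puts the site in the height window. [folklore] -/
theorem nearPlane_of_hV_ne_zero {x : Tor (fine n M)} (h : hV n M μ R β x ≠ 0) : NearPlane n M μ R β x := by
  unfold hV at h
  split_ifs at h with h1 h2
  · exact Or.inl ⟨h1, by have := le_of_qprof_ne_zero hR h; omega⟩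
  · exact Or.inr ⟨h2, by have := le_of_qprof_ne_zero hR h; omega⟩
  · exact absurd rfl h

omit hn in
/-- a non-vanishing window OFF the own range puts the site near that face. [folklore] -/
theorem nearFace_of_Wax_ne_zero {κ : Fin d} {x : Tor (fine n M)} (h : Wax n M R β κ x ≠ 0) (h0 : blockOf n M x κ ≠ β κ) :
    NearFace n M R β κ x := by
  unfold Wax at h
  rw [if_neg h0] at h
  by_cases h1 : blockOf n M x κ = β κ + 1
  · by_cases hq : qprof R R (offsF n M x κ : ℕ) = 0
    · rw [if_pos h1, hq, zero_add] at h
      split_ifs at h with h2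
      · exact Or.inr (Or.inr ⟨h2, by have := le_of_qprof_ne_zero hR h; omega⟩)
      · exact absurd rfl h
    · exact Or.inr (Or.inl ⟨h1, by have := le_of_qprof_ne_zero hR hq; omega⟩)
  · rw [if_neg h1, zero_add] at h
    split_ifs at h with h2
    · exact Or.inr (Or.inr ⟨h2, by have := le_of_qprof_ne_zero hR h; omega⟩)
    · exact absurd rfl h

/-- the window at the LAST `κ`-layer of a block: non-zero only on the own range or the previous one. [folklore] -/
theorem Wax_last {κ : Fin d} {x : Tor (fine n M)} (hr : (offsF n M x κ : ℕ) + 1 = n) (h : Wax n M R β κ x ≠ 0) :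
    blockOf n M x κ = β κ ∨ blockOf n M x κ = β κ - 1 := by
  by_cases h0 : blockOf n M x κ = β κ
  · exact Or.inl h0
  · unfold Wax at h
    rw [if_neg h0, show (offsF n M x κ : ℕ) = n - 1 by omega, (q_values (n := n) hR hn).2.2.2.2.1] at h
    by_cases h2 : blockOf n M x κ = β κ - 1
    · exact Or.inr h2
    · rw [if_neg h2] at h; simp at h

/-- the window at the last layer vanishes off those two ranges, and then also one layer before. [folklore] -/
theorem Wax_last_prev_eq_zero {κ : Fin d} {x : Tor (fine n M)} (hr : (offsF n M x κ : ℕ) + 1 = n) (h : Wax n M R β κ x = 0) :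
    Wax n M R β κ (x - unitVec (fine n M) κ) = 0 := by
  obtain ⟨q0, q1, q2, qn2, qn1, qn⟩ := q_values (n := n) hR hn
  have h0 : blockOf n M x κ ≠ β κ := fun h0 => by unfold Wax at h; rw [if_pos h0] at h; exact one_ne_zero h
  have h2 : blockOf n M x κ ≠ β κ - 1 := fun h2 => by
    unfold Wax at h; rw [if_neg h0, if_pos h2, show n - 1 - (offsF n M x κ : ℕ) = 0 by omega, q0] at h
    have : (0 : ℝ) ≤ (if blockOf n M x κ = β κ + 1 then qprof R R (offsF n M x κ : ℕ) else 0) := by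
      split_ifs; exacts [(ScaleProfile.qprof_mem hR R _).1, le_rfl]
    linarith
  rcases blockOf_offsF_sub n M x κ with ⟨-, hb, ho, -⟩ | ⟨hz, -, -, -⟩
  · unfold Wax
    rw [hb, if_neg h0, if_neg h2, ho, show (offsF n M x κ : ℕ) - 1 = n - 2 by omega, qn2]
    split_ifs <;> simp
  · omega

/-- the window at the FIRST `κ`-layer: zero forces zero one layer after. [folklore] -/
theorem Wax_first_next_eq_zero {κ : Fin d} {x : Tor (fine n M)} (hr : (offsF n M x κ : ℕ) = 0) (h : Wax n M R β κ x = 0) :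
    Wax n M R β κ (x + unitVec (fine n M) κ) = 0 := by
  obtain ⟨q0, q1, q2, qn2, qn1, qn⟩ := q_values (n := n) hR hn
  have h0 : blockOf n M x κ ≠ β κ := fun h0 => by unfold Wax at h; rw [if_pos h0] at h; exact one_ne_zero h
  have h1 : blockOf n M x κ ≠ β κ + 1 := fun h1 => by
    unfold Wax at h; rw [if_neg h0, if_pos h1, hr, q0] at h
    have : (0 : ℝ) ≤ (if blockOf n M x κ = β κ - 1 then qprof R R (n - 1 - 0) else 0) := by
      split_ifs; exacts [(ScaleProfile.qprof_mem hR R _).1, le_rfl]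
    linarith
  have hlt : (offsF n M x κ : ℕ) + 1 < n := by omega
  obtain ⟨hb, ho⟩ := blockOf_offsF_add_of_lt n M x κ hlt
  unfold Wax
  rw [hb, if_neg h0, if_neg h1, ho, Function.update_self]
  show (0 : ℝ) + (if blockOf n M x κ = β κ - 1 then qprof R R (n - 1 - ((offsF n M x κ : ℕ) + 1)) else 0) = 0
  rw [hr, show n - 1 - (0 + 1) = n - 2 by omega, qn2]; split_ifs <;> simp

/-- `Gs = 0` propagates one layer back from the last `κ`-layer (`κ ≠ μ`). [folklore] -/
theorem Gs_prev_eq_zero {κ : Fin d} (hκ : κ ≠ μ) {x : Tor (fine n M)} (hr : (offsF n M x κ : ℕ) + 1 = n) (h : Gs n M S μ R β x = 0) :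
    Gs n M S μ R β (x - unitVec (fine n M) κ) = 0 := by
  by_cases hBE : BotExp M S μ β
  · rw [Gs_eq_of_botExp hBE] at h ⊢
    rw [hV_sub_of_ne β hκ]
    rcases mul_eq_zero.mp h with h' | h'
    · rw [h', zero_mul]
    · obtain ⟨lam, hl, hW⟩ := Finset.prod_eq_zero_iff.mp h'
      have hlμ : lam ≠ μ := Finset.ne_of_mem_erase hl
      by_cases hlκ : lam = κ
      · subst hlκ; rw [Ptr_eq_zero_of hlμ (Wax_last_prev_eq_zero hR hn hr hW), mul_zero]
      · rw [Ptr_eq_zero_of hlμ (by rw [Wax_sub_of_ne β (fun h => hlκ h.symm)]; exact hW), mul_zero]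
  · exact Gs_eq_zero_of_not_botExp hBE _

/-- `Gs = 0` propagates one layer forward from the first `κ`-layer (`κ ≠ μ`). [folklore] -/
theorem Gs_next_eq_zero {κ : Fin d} (hκ : κ ≠ μ) {x : Tor (fine n M)} (hr : (offsF n M x κ : ℕ) = 0) (h : Gs n M S μ R β x = 0) :
    Gs n M S μ R β (x + unitVec (fine n M) κ) = 0 := by
  by_cases hBE : BotExp M S μ β
  · rw [Gs_eq_of_botExp hBE] at h ⊢
    rw [hV_add_of_ne β hκ]
    rcases mul_eq_zero.mp h with h' | h'
    · rw [h', zero_mul]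
    · obtain ⟨lam, hl, hW⟩ := Finset.prod_eq_zero_iff.mp h'
      have hlμ : lam ≠ μ := Finset.ne_of_mem_erase hl
      by_cases hlκ : lam = κ
      · subst hlκ; rw [Ptr_eq_zero_of hlμ (Wax_first_next_eq_zero hR hn hr hW), mul_zero]
      · rw [Ptr_eq_zero_of hlμ (by rw [Wax_add_of_ne β (fun h => hlκ h.symm)]; exact hW), mul_zero]
  · exact Gs_eq_zero_of_not_botExp hBE _

/-- **THE CORNER LEMMA**: in the layer below `β`, a transversal face crossing INSIDE `Ω` at which the smooth part of the dip is non-zero is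
near a bottom corner cell of `β` — at both ends of the bond. [folklore] -/
theorem nearCorner_of_lower_cross (hBE : BotExp M S μ β) {κ : Fin d} (hκ : κ ≠ μ) {x : Tor (fine n M)} (hr : (offsF n M x κ : ℕ) + 1 = n)
    (hx : S (blockOf n M x)) (hy : S (blockOf n M (x + unitVec (fine n M) κ))) (hlow : blockOf n M x μ = β μ - 1)
    (hG : Gs n M S μ R β x ≠ 0) : NearCorner n M μ R β x ∧ NearCorner n M μ R β (x + unitVec (fine n M) κ) := by
  obtain ⟨hb, ho⟩ := blockOf_offsF_add_of_eq n M x κ hr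
  rw [Gs_eq_of_botExp hBE] at hG
  have hV0 : hV n M μ R β x ≠ 0 := fun h => hG (by rw [h, zero_mul])
  have hP0 : Ptr n M μ R β x ≠ 0 := fun h => hG (by rw [h, mul_zero])
  have hW : ∀ lam, lam ≠ μ → Wax n M R β lam x ≠ 0 := fun lam hl =>
    (Finset.prod_ne_zero_iff.mp hP0) lam (Finset.mem_erase.mpr ⟨hl, Finset.mem_univ _⟩)
  have hplane : NearPlane n M μ R β x := nearPlane_of_hV_ne_zero hR hV0
  have hplane' : NearPlane n M μ R β (x + unitVec (fine n M) κ) := by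
    unfold NearPlane; rw [hb, ho, add_unitVec_ne M _ (Ne.symm hκ), Function.update_of_ne (Ne.symm hκ)]; exact hplane
  have hκface : NearFace n M R β κ x := by
    rcases Wax_last hR hn hr (hW κ hκ) with h0 | h0
    · exact Or.inl ⟨h0, Or.inr (by omega)⟩
    · exact Or.inr (Or.inr ⟨h0, by omega⟩)
  have hκface' : NearFace n M R β κ (x + unitVec (fine n M) κ) := by
    unfold NearFace; rw [hb, ho, add_unitVec_self, Function.update_self, Fin.val_zero]
    rcases Wax_last hR hn hr (hW κ hκ) with h0 | h0
    · exact Or.inr (Or.inl ⟨by rw [h0], Nat.zero_le _⟩)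
    · exact Or.inl ⟨by rw [h0, sub_add_cancel], Or.inl (Nat.zero_le _)⟩
  -- some other transversal coordinate must differ from `β`
  have hex : ∃ lam, lam ≠ μ ∧ lam ≠ κ ∧ blockOf n M x lam ≠ β lam := by
    by_contra hall
    push Not at hall
    rcases Wax_last hR hn hr (hW κ hκ) with h0 | h0
    · -- the block of `x` is `β − e_μ`
      have : blockOf n M x = β - unitVec M μ := by
        funext lam
        by_cases h1 : lam = μ
        · subst h1; rw [sub_unitVec_self]; exact hlow
        · rw [sub_unitVec_ne M _ h1]
          by_cases h2 : lam = κ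
          · subst h2; exact h0
          · exact hall lam h1 h2
      exact hBE.2 (this ▸ hx)
    · -- the block of `x + e_κ` is `β − e_μ`
      have : blockOf n M (x + unitVec (fine n M) κ) = β - unitVec M μ := by
        rw [hb]; funext lam
        by_cases h1 : lam = μ
        · subst h1; rw [sub_unitVec_self, add_unitVec_ne M _ (Ne.symm hκ)]; exact hlow
        · rw [sub_unitVec_ne M _ h1]
          by_cases h2 : lam = κ
          · subst h2; rw [add_unitVec_self, h0, sub_add_cancel]
          · rw [add_unitVec_ne M _ h2]; exact hall lam h1 h2
      exact hBE.2 (this ▸ hy)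
  obtain ⟨lam, hlμ, hlκ, hne⟩ := hex
  have hlface : NearFace n M R β lam x := nearFace_of_Wax_ne_zero hR (hW lam hlμ) hne
  have hlface' : NearFace n M R β lam (x + unitVec (fine n M) κ) := by
    unfold NearFace; rw [hb, ho, add_unitVec_ne M _ hlκ, Function.update_of_ne hlκ]; exact hlface
  -- the window clause: every transversal window is non-zero at `x`, and at `x + e_κ` (unchanged off `κ`)
  have hwin : ∀ l : Fin d, l ≠ μ → blockOf n M x l = β l ∨ NearFace n M R β l x := fun l hl => by
    by_cases h0 : blockOf n M x l = β l
    · exact Or.inl h0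
    · exact Or.inr (nearFace_of_Wax_ne_zero hR (hW l hl) h0)
  have hwin' : ∀ l : Fin d, l ≠ μ → blockOf n M (x + unitVec (fine n M) κ) l = β l ∨ NearFace n M R β l (x + unitVec (fine n M) κ) := by
    intro l hl
    by_cases hlk : l = κ
    · subst hlk; exact Or.inr hκface'
    · rcases hwin l hl with h0 | h0
      · exact Or.inl (by rw [hb, add_unitVec_ne M _ hlk]; exact h0)
      · right; unfold NearFace; rw [hb, ho, add_unitVec_ne M _ hlk, Function.update_of_ne hlk]; exact h0
  exact ⟨⟨hplane, ⟨κ, lam, hκ, hlμ, Ne.symm hlκ, hκface, hlface⟩, hwin⟩, ⟨hplane', ⟨κ, lam, hκ, hlμ, Ne.symm hlκ, hκface', hlface'⟩, hwin'⟩⟩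

end Supports

/-! ## §3 The dips along `μ` -/

section Mu

variable {n M μ R} {S : Tor M → Prop} [DecidablePred S] (hR : 2 ≤ R) (hn : 4 * R ≤ n) (β : Tor M)
include hR hn

omit hR hn in
/-- scalar factor in `[0,1]`, multiplication on the right. [folklore] -/
theorem abs_sub_mul_le {u v a : ℝ} (h0 : 0 ≤ a) (h1 : a ≤ 1) : |u * a - v * a| ≤ |u - v| := by
  rw [← sub_mul, abs_mul, abs_of_nonneg h0]; exact mul_le_of_le_one_right (abs_nonneg _) h1

/-- **dip steps along `μ`** inside `Ω`: `≤ 2·lip1 R`. [folklore] -/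
theorem dip_step_mu {x : Tor (fine n M)} (hy : blockReg n M S (x + unitVec (fine n M) μ)) :
    |dip n M S μ R β (x + unitVec (fine n M) μ) - dip n M S μ R β x| ≤ 2 * lip1 R := by
  have hl1 := lip1_nonneg hR
  unfold dip
  rcases Nat.lt_or_ge ((offsF n M x μ : ℕ) + 1) n with hlt | hge
  · obtain ⟨hb, -⟩ := blockOf_offsF_add_of_lt n M x μ hlt
    have hc : conn n M S μ β (x + unitVec (fine n M) μ) = conn n M S μ β x := by unfold conn; rw [hb]
    rw [hc]
    have hcm := conn_mem (n := n) (S := S) (μ := μ) β x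
    exact (abs_sub_mul_le hcm.1 hcm.2).trans (Gs_step hR hn β μ x)
  · have heq : (offsF n M x μ : ℕ) + 1 = n := le_antisymm (offsF n M x μ).isLt hge
    obtain ⟨hb, -⟩ := blockOf_offsF_add_of_eq n M x μ heq
    rw [Gs_cross hR hn β μ heq]
    by_cases h1 : blockOf n M x μ = β μ
    · rw [show Gs n M S μ R β x = 0 from by
        by_cases hBE : BotExp M S μ β
        · rw [Gs_eq_of_botExp hBE, hV_eq_zero_of_top hR hn h1 (by omega), zero_mul]
        · exact Gs_eq_zero_of_not_botExp hBE _]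
      simp; positivity
    · by_cases h2 : blockOf n M x μ = β μ - 1
      · have hS : S (blockOf n M x + unitVec M μ) := by have := hy; unfold blockReg at this; rwa [hb] at this
        rw [conn_eq_of_dn h1 h2, if_pos hS, conn_eq_one_of_up (by rw [hb, add_unitVec_self, h2, sub_add_cancel]), sub_self, abs_zero]
        positivity
      · rw [show Gs n M S μ R β x = 0 from by
          by_cases hBE : BotExp M S μ β
          · rw [Gs_eq_of_botExp hBE, hV_eq_zero_of_far h1 h2, zero_mul]
          · exact Gs_eq_zero_of_not_botExp hBE _]
        simp; positivity

/-- **dip second differences along `μ`** inside `Ω`: `≤ 2·lip2 R`. [folklore] -/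
theorem dip_second_mu {x : Tor (fine n M)} (hx : blockReg n M S x) (hp : blockReg n M S (x + unitVec (fine n M) μ)) :
    |2 * dip n M S μ R β x - dip n M S μ R β (x + unitVec (fine n M) μ) - dip n M S μ R β (x - unitVec (fine n M) μ)| ≤ 2 * lip2 R := by
  have hl2 : 0 ≤ lip2 R := lip2_nonneg
  have h2l : (0 : ℝ) ≤ 2 * lip2 R := by positivity
  by_cases hBE : BotExp M S μ β
  swap
  · unfold dip; rw [Gs_eq_zero_of_not_botExp hBE, Gs_eq_zero_of_not_botExp hBE, Gs_eq_zero_of_not_botExp hBE]; simp; positivity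
  have h10 := one_ne_zero_of_botExp hBE
  have hββ : β μ - 1 ≠ β μ := fun h => h10 (by have := congrArg (fun z => β μ - z) h; simpa using this)
  unfold dip
  set t := (offsF n M x μ : ℕ) with ht
  rcases blockOf_offsF_sub n M x μ with ⟨hne, hbm, hom, -⟩ | ⟨h0, hbm, hom, -⟩
  · rcases Nat.lt_or_ge (t + 1) n with hlt | hge
    · -- interior: the indicator is constant on the triple
      obtain ⟨hb, -⟩ := blockOf_offsF_add_of_lt n M x μ hlt
      have hc1 : conn n M S μ β (x + unitVec (fine n M) μ) = conn n M S μ β x := by unfold conn; rw [hb]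
      have hc2 : conn n M S μ β (x - unitVec (fine n M) μ) = conn n M S μ β x := by unfold conn; rw [hbm]
      rw [hc1, hc2]
      have hcm := conn_mem (n := n) (S := S) (μ := μ) β x
      calc |2 * (Gs n M S μ R β x * conn n M S μ β x) - Gs n M S μ R β (x + unitVec (fine n M) μ) * conn n M S μ β x
              - Gs n M S μ R β (x - unitVec (fine n M) μ) * conn n M S μ β x|
          = |conn n M S μ β x| * |2 * Gs n M S μ R β x - Gs n M S μ R β (x + unitVec (fine n M) μ) - Gs n M S μ R β (x - unitVec (fine n M) μ)| := by
            rw [← abs_mul]; congr 1; ring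
        _ ≤ 1 * _ := mul_le_mul_of_nonneg_right (by rw [abs_of_nonneg hcm.1]; exact hcm.2) (abs_nonneg _)
        _ ≤ 2 * lip2 R := by rw [one_mul]; exact Gs_second hR hn β μ x
    · -- top layer: `x + e_μ` across the face
      have heq : t + 1 = n := le_antisymm (offsF n M x μ).isLt hge
      obtain ⟨hb, -⟩ := blockOf_offsF_add_of_eq n M x μ heq
      rw [Gs_cross hR hn β μ heq]
      by_cases h1 : blockOf n M x μ = β μ
      · -- all three smooth parts vanish
        have g0 : Gs n M S μ R β x = 0 := by rw [Gs_eq_of_botExp hBE, hV_eq_zero_of_top hR hn h1 (by omega), zero_mul]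
        have g1 : Gs n M S μ R β (x - unitVec (fine n M) μ) = 0 := by
          rw [Gs_eq_of_botExp hBE, hV_eq_zero_of_top hR hn (by rw [hbm]; exact h1) (by rw [hom]; omega), zero_mul]
        rw [g0, g1]; simp; positivity
      · by_cases h2 : blockOf n M x μ = β μ - 1
        · -- all three indicators equal `1`
          have hS : S (blockOf n M x + unitVec M μ) := by have := hp; unfold blockReg at this; rwa [hb] at this
          have c0 : conn n M S μ β x = 1 := by rw [conn_eq_of_dn h1 h2, if_pos hS]
          have c1 : conn n M S μ β (x + unitVec (fine n M) μ) = 1 := conn_eq_one_of_up (by rw [hb, add_unitVec_self, h2, sub_add_cancel])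
          have c2 : conn n M S μ β (x - unitVec (fine n M) μ) = 1 := by
            rw [conn_eq_of_dn (by rw [hbm]; exact h1) (by rw [hbm]; exact h2), hbm, if_pos hS]
          simp only [c0, c1, c2, mul_one]
          have := Gs_second (S := S) (μ := μ) hR hn β μ x
          rw [Gs_cross hR hn β μ heq] at this; exact this
        · have g0 : Gs n M S μ R β x = 0 := by rw [Gs_eq_of_botExp hBE, hV_eq_zero_of_far h1 h2, zero_mul]
          have g1 : Gs n M S μ R β (x - unitVec (fine n M) μ) = 0 := by
            rw [Gs_eq_of_botExp hBE, hV_eq_zero_of_far (by rw [hbm]; exact h1) (by rw [hbm]; exact h2), zero_mul]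
          rw [g0, g1]; simp; positivity
  · -- bottom layer: `x − e_μ` across the face below; `Gs x = Gs (x − e_μ)` by cross-continuity at `x − e_μ`
    have hlt : t + 1 < n := by omega
    obtain ⟨hb, -⟩ := blockOf_offsF_add_of_lt n M x μ hlt
    have hcr : Gs n M S μ R β x = Gs n M S μ R β (x - unitVec (fine n M) μ) := by
      have := Gs_cross hR hn (S := S) (μ := μ) (R := R) β μ (x := x - unitVec (fine n M) μ) (by rw [hom]; omega)
      rw [sub_add_cancel] at this; exact this
    have hc1 : conn n M S μ β (x + unitVec (fine n M) μ) = conn n M S μ β x := by unfold conn; rw [hb]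
    by_cases h1 : blockOf n M x μ = β μ
    · have c0 : conn n M S μ β x = 1 := conn_eq_one_of_up h1
      have hb1 : blockOf n M (x - unitVec (fine n M) μ) μ = β μ - 1 := by rw [hbm, sub_unitVec_self, h1]
      have c2 : conn n M S μ β (x - unitVec (fine n M) μ) = 1 := by
        rw [conn_eq_of_dn (by rw [hb1]; exact hββ) hb1, hbm, sub_add_cancel, if_pos (show S (blockOf n M x) from hx)]
      simp only [hc1, c0, c2, mul_one]; exact Gs_second hR hn β μ x
    · by_cases h2 : blockOf n M x μ = β μ - 1
      · have g0 : Gs n M S μ R β x = 0 := by rw [Gs_eq_of_botExp hBE, hV_eq_zero_of_bot hR hn h1 h2 (by omega), zero_mul]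
        have g2 : Gs n M S μ R β (x + unitVec (fine n M) μ) = 0 := by
          obtain ⟨hb', ho'⟩ := blockOf_offsF_add_of_lt n M x μ hlt
          rw [Gs_eq_of_botExp hBE, hV_eq_zero_of_bot hR hn (by rw [hb']; exact h1) (by rw [hb']; exact h2)
            (by rw [ho', Function.update_self]; show t + 1 ≤ 1; omega), zero_mul]
        rw [← hcr, g0, g2]; simp; positivity
      · have g0 : Gs n M S μ R β x = 0 := by rw [Gs_eq_of_botExp hBE, hV_eq_zero_of_far h1 h2, zero_mul]
        have g2 : Gs n M S μ R β (x + unitVec (fine n M) μ) = 0 := by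
          obtain ⟨hb', -⟩ := blockOf_offsF_add_of_lt n M x μ hlt
          rw [Gs_eq_of_botExp hBE, hV_eq_zero_of_far (by rw [hb']; exact h1) (by rw [hb']; exact h2), zero_mul]
        rw [← hcr, g0, g2]; simp; positivity

end Mu

end Summit.QuantumFields.BalabanUV.T4Continuum.DirichletDipCutoffCorner

end
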